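import Summits.BirchSwinnertonDyer.BirchSwinnertonDyer.Theorems.ResidualThetaTransportAtTwoResidualSignedLambdaLowerCMAtTwoFourTermOneSided
import Literature.Algebra.Module.CharacterModuleExact
import Literature.Algebra.Module.CharacterModuleRankSequences
import HarnessLib

/-!
# N6 algebra for RSL_g: the IMPRIMITIVE INCREMENT `λ(Sel_{S₀}⋆) ≥ λ(Sel_∅⋆) + Σ` by Pontryagin dualization

Route `ResidualThetaTransportAtTwo` (RTT), crux RSL_g `ResidualSignedLambdaLowerCMAtTwo` (stmt-BirchSwinnertonDyer-22608;
the (R≥)ᵖ crux stmt-BirchSwinnertonDyer-26074 is glue above it), DAG node N6 (`RSLG-LINE-DAG-g14.md`; STUB-PLAN rev 5 §3.1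
`stub_imprimitiveFinite`). Seat `prover-bsd-wall-rtt-p2` g16 (`--supports`, closes nothing). THEOREMS ONLY (no definition,
no named fact, no instance, no `sorry`); pure module algebra in λ-currency `dim_K (K ⊗_A ·)`, `K = Frac A`, on Mathlib's
untopologised Pontryagin dual `M⋆ = CharacterModule M` (with the tree's `Literature.Algebra.Module.CharacterModule.exact_dual`);
nothing about curves or Galois cohomology; BSD is not proved by any of this; 22608 / 26074 stay OPEN.

## Setting (Greenberg–Vatsal §2 at the level of duals)
`res : SelS → PS` `A`-linear (`SelS = Sel⁺_{S₀}(ℚ_∞, A_g)`, `PS = ⊕_{v ∈ S₀} H¹(ℚ_{∞,v}, A_g)`, `Sel_∅ = ker res`).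
Dualizing `0 → ker res → SelS → im res → 0` and `0 → im res → PS → PS/im res → 0`:
* §1 **`finrank_baseChange_characterModule_eq_add_ker_range`** — `λ(SelS⋆) = λ((im res)⋆) + λ((ker res)⋆)`;
  **`finrank_baseChange_characterModule_eq_add_quotient`** — `λ(M⋆) = λ((M/N)⋆) + λ(N⋆)`; finiteness inheritances.
* §2 **`add_le_finrank_baseChange_characterModule_of_res`** — THE N6 SHAPE: `m ≤ λ((ker res)⋆)` and
  `s + λ((PS/im res)⋆) ≤ λ(PS⋆)` give `m + s ≤ λ(SelS⋆)`; and **`…_of_smul_eq_zero`**: if the cokernel `PS/im res` is killed by a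
  non-zero scalar (GV surjectivity «up to finite», the Poitou–Tate content of N6) then `s ≤ λ(PS⋆)` suffices.
So the N6 duty of the 22608 line is: `res_{S₀}` on the real carriers, the local count `Σ_g(S₀) ≤ λ(PS⋆)` (tree: p627158 /
p646049 / `…EulerFactor*AtTwo`), and the cokernel bound.

References: [GreenbergVatsal2000] §2 (Prop. 2.1, Cor. 2.3); [Greenberg2006] §2 A; [Washington1997] §13.2.
-/

set_option autoImplicit false
-- the Theorems namespace of this sub repeats the summit name by design (D-0017 nested layout)
set_option linter.dupNamespace false

noncomputable section

open scoped TensorProduct Classical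

namespace Summit.BirchSwinnertonDyer.BirchSwinnertonDyer.Theorems.CharIdealLambda

open Literature.Algebra.Module

universe u v w

section Additivity

variable {A : Type u} [CommRing A] (K : Type w) [Field K] [Algebra A K] [IsFractionRing A K]
  {SelS : Type v} [AddCommGroup SelS] [Module A SelS]
  {PS : Type v} [AddCommGroup PS] [Module A PS]

/-! ## §1 λ-additivity of Pontryagin duals along `ker`/`im` and submodule/quotient -/

/-- **`λ(SelS⋆) = λ((im res)⋆) + λ((ker res)⋆)`** for an `A`-linear `res : SelS → PS` with `K ⊗ SelS⋆` finite-dimensional: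
`0 → (im res)⋆ → SelS⋆ → (ker res)⋆ → 0` is exact (`ℚ/ℤ` injective; exactness in the middle =
`CharacterModule.exact_dual_rangeRestrict_dual_subtype`). [cite: Greenberg2006, §2 A (p. 348)] [cite: Washington1997, §13.2] -/
theorem finrank_baseChange_characterModule_eq_add_ker_range (res : SelS →ₗ[A] PS)
    [Module.Finite K (K ⊗[A] CharacterModule SelS)] :
    Module.finrank K (K ⊗[A] CharacterModule SelS) =
      Module.finrank K (K ⊗[A] CharacterModule (LinearMap.range res)) +
        Module.finrank K (K ⊗[A] CharacterModule (LinearMap.ker res)) :=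
  LambdaLowerBoundO.finrank_baseChange_eq_of_exact_three K
    (CharacterModule.dual (R := A) res.rangeRestrict) (CharacterModule.dual (R := A) (LinearMap.ker res).subtype)
    (CharacterModule.dual_injective_of_surjective _ (LinearMap.surjective_rangeRestrict res))
    (CharacterModule.exact_dual_rangeRestrict_dual_subtype res)
    (CharacterModule.dual_surjective_of_injective _ (LinearMap.ker res).injective_subtype)

/-- **`λ(M⋆) = λ((M/N)⋆) + λ(N⋆)`** for a submodule `N ≤ M` with `K ⊗ M⋆` finite-dimensional (`0 → (M/N)⋆ → M⋆ → N⋆ → 0`).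
[cite: Greenberg2006, §2 A (p. 348)] [cite: Washington1997, §13.2] -/
theorem finrank_baseChange_characterModule_eq_add_quotient (N : Submodule A PS)
    [Module.Finite K (K ⊗[A] CharacterModule PS)] :
    Module.finrank K (K ⊗[A] CharacterModule PS) =
      Module.finrank K (K ⊗[A] CharacterModule (PS ⧸ N)) + Module.finrank K (K ⊗[A] CharacterModule N) :=
  LambdaLowerBoundO.finrank_baseChange_eq_of_exact_three K
    (CharacterModule.dual (R := A) N.mkQ) (CharacterModule.dual (R := A) N.subtype)
    (CharacterModule.dual_injective_of_surjective _ N.mkQ_surjective)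
    (CharacterModule.exact_dual (LinearMap.exact_subtype_mkQ N))
    (CharacterModule.dual_surjective_of_injective _ N.injective_subtype)

omit [IsFractionRing A K] in
/-- `K ⊗ (ker res)⋆` is finite-dimensional when `K ⊗ SelS⋆` is (a quotient). [folklore] -/
theorem finite_baseChange_characterModule_ker (res : SelS →ₗ[A] PS)
    [Module.Finite K (K ⊗[A] CharacterModule SelS)] :
    Module.Finite K (K ⊗[A] CharacterModule (LinearMap.ker res)) := by
  refine Module.Finite.of_surjective ((CharacterModule.dual (R := A) (LinearMap.ker res).subtype).baseChange K) ?_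
  rw [LinearMap.baseChange_eq_ltensor]
  exact LinearMap.lTensor_surjective K
    (CharacterModule.dual_surjective_of_injective _ (LinearMap.ker res).injective_subtype)

/-- `K ⊗ (M/N)⋆` is finite-dimensional when `K ⊗ M⋆` is (a submodule after the flat base change). [folklore] -/
theorem finite_baseChange_characterModule_quotient (N : Submodule A PS)
    [Module.Finite K (K ⊗[A] CharacterModule PS)] :
    Module.Finite K (K ⊗[A] CharacterModule (PS ⧸ N)) := by
  haveI : Module.Flat A K := IsLocalization.flat K (nonZeroDivisors A)
  refine Module.Finite.of_injective ((CharacterModule.dual (R := A) N.mkQ).baseChange K) ?_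
  rw [LinearMap.baseChange_eq_ltensor]
  exact Module.Flat.lTensor_preserves_injective_linearMap _
    (CharacterModule.dual_injective_of_surjective _ N.mkQ_surjective)

omit [IsFractionRing A K] in
/-- `K ⊗ N⋆` is finite-dimensional when `K ⊗ M⋆` is (a quotient). [folklore] -/
theorem finite_baseChange_characterModule_submodule (N : Submodule A PS)
    [Module.Finite K (K ⊗[A] CharacterModule PS)] :
    Module.Finite K (K ⊗[A] CharacterModule N) := by
  refine Module.Finite.of_surjective ((CharacterModule.dual (R := A) N.subtype).baseChange K) ?_
  rw [LinearMap.baseChange_eq_ltensor]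
  exact LinearMap.lTensor_surjective K (CharacterModule.dual_surjective_of_injective _ N.injective_subtype)

/-- **A dual killed by a non-zero scalar is `λ`-invisible**: if `a ≠ 0` kills `M` then `K ⊗ M⋆ = 0`. [folklore] -/
theorem finrank_baseChange_characterModule_eq_zero_of_smul_eq_zero [IsDomain A] {M : Type v} [AddCommGroup M]
    [Module A M] {a : A} (ha : a ≠ 0) (h : ∀ x : M, a • x = 0) :
    Module.finrank K (K ⊗[A] CharacterModule M) = 0 := by
  haveI : Subsingleton (K ⊗[A] CharacterModule M) := by
    refine subsingleton_baseChange_of_pow_smul_eq_zero K ha 1 fun φ ↦ ?_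
    ext x
    rw [pow_one, CharacterModule.smul_apply, h x, map_zero]
    rfl
  exact Module.finrank_zero_of_subsingleton

/-! ## §2 The N6 shape -/

/-- **THE N6 INCREMENT (imprimitive Selmer dual).** For `A`-linear `res : SelS → PS` with `K ⊗ SelS⋆` and `K ⊗ PS⋆`
finite-dimensional: `m ≤ λ((ker res)⋆)` (the primitive bound, `ker res = Sel_∅`) and `s + λ((PS/im res)⋆) ≤ λ(PS⋆)` (the local
count net of the cokernel) give `m + s ≤ λ(SelS⋆)`. [cite: GreenbergVatsal2000, §2 (Cor. 2.3)] [cite: Washington1997, §13.2] -/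
theorem add_le_finrank_baseChange_characterModule_of_res (res : SelS →ₗ[A] PS)
    [Module.Finite K (K ⊗[A] CharacterModule SelS)] [Module.Finite K (K ⊗[A] CharacterModule PS)] {m s : ℕ}
    (hm : m ≤ Module.finrank K (K ⊗[A] CharacterModule (LinearMap.ker res)))
    (hs : s + Module.finrank K (K ⊗[A] CharacterModule (PS ⧸ LinearMap.range res)) ≤
      Module.finrank K (K ⊗[A] CharacterModule PS)) :
    m + s ≤ Module.finrank K (K ⊗[A] CharacterModule SelS) := by
  have h1 := finrank_baseChange_characterModule_eq_add_ker_range K res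
  have h2 := finrank_baseChange_characterModule_eq_add_quotient K (LinearMap.range res)
  omega

/-- **N6 with the cokernel killed by a non-zero scalar** (GV surjectivity `Sel⁺_{S₀} ↠ ⊕_{v∈S₀} H¹(ℚ_{∞,v}, A_g)` up to a
bounded finite group — the Poitou–Tate content of N6): then `m ≤ λ((ker res)⋆)` and `s ≤ λ(PS⋆)` give `m + s ≤ λ(SelS⋆)`.
[cite: GreenbergVatsal2000, §2 (Prop. 2.1, Cor. 2.3)] -/
theorem add_le_finrank_baseChange_characterModule_of_res_of_smul_eq_zero [IsDomain A] (res : SelS →ₗ[A] PS)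
    [Module.Finite K (K ⊗[A] CharacterModule SelS)] [Module.Finite K (K ⊗[A] CharacterModule PS)] {m s : ℕ}
    (hm : m ≤ Module.finrank K (K ⊗[A] CharacterModule (LinearMap.ker res)))
    (hs : s ≤ Module.finrank K (K ⊗[A] CharacterModule PS)) {a : A} (ha : a ≠ 0)
    (hcok : ∀ x : PS ⧸ LinearMap.range res, a • x = 0) :
    m + s ≤ Module.finrank K (K ⊗[A] CharacterModule SelS) :=
  add_le_finrank_baseChange_characterModule_of_res K res hm
    (by rw [finrank_baseChange_characterModule_eq_zero_of_smul_eq_zero K ha hcok, add_zero]; exact hs)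

/-- **N6 when `res` is onto** (exact GV surjectivity): `m ≤ λ((ker res)⋆)`, `s ≤ λ(PS⋆)` ⇒ `m + s ≤ λ(SelS⋆)`.
[cite: GreenbergVatsal2000, §2 (Cor. 2.3)] -/
theorem add_le_finrank_baseChange_characterModule_of_surjective [IsDomain A] (res : SelS →ₗ[A] PS)
    (hres : Function.Surjective res)
    [Module.Finite K (K ⊗[A] CharacterModule SelS)] [Module.Finite K (K ⊗[A] CharacterModule PS)] {m s : ℕ}
    (hm : m ≤ Module.finrank K (K ⊗[A] CharacterModule (LinearMap.ker res)))
    (hs : s ≤ Module.finrank K (K ⊗[A] CharacterModule PS)) :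
    m + s ≤ Module.finrank K (K ⊗[A] CharacterModule SelS) :=
  add_le_finrank_baseChange_characterModule_of_res_of_smul_eq_zero K res hm hs one_ne_zero fun x ↦ by
    induction x using Submodule.Quotient.induction_on with
    | H y => rw [one_smul, Submodule.Quotient.mk_eq_zero, LinearMap.range_eq_top.mpr hres]; exact Submodule.mem_top

end Additivity

/-! ## §3 Duals of finite products: `λ((Π_i M_i)⋆) = Σ_i λ(M_i⋆)` -/

section Pi

variable {A : Type u} [CommRing A] (K : Type w) [Field K] [Algebra A K]
  {ι : Type} [Fintype ι] [DecidableEq ι] (M : ι → Type v) [∀ i, AddCommGroup (M i)] [∀ i, Module A (M i)]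

omit [Fintype ι] [DecidableEq ι] in
/-- Evaluation of a finite sum of characters (the `FunLike` coercion of `CharacterModule` is additive). [folklore] -/
theorem characterModule_sum_apply {X : Type v} [AddCommGroup X] (s : Finset ι) (c : ι → CharacterModule X) (x : X) :
    (∑ i ∈ s, c i) x = ∑ i ∈ s, c i x := by
  induction s using Finset.cons_induction with
  | empty => rfl
  | cons a s ha ih => rw [Finset.sum_cons, Finset.sum_cons, ← ih]; rfl

/-- The dual of a finite product is the product of the duals, `A`-linearly: `φ ↦ (φ ∘ single_i)_i`, inverse
`(ψ_i)_i ↦ Σ_i ψ_i ∘ proj_i`. [folklore] -/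
theorem exists_characterModule_pi_linearEquiv :
    ∃ e : CharacterModule (Π i, M i) ≃ₗ[A] (Π i, CharacterModule (M i)),
      ∀ φ i (x : M i), e φ i x = φ (Pi.single i x) := by
  refine ⟨{ toFun := fun φ i ↦ CharacterModule.dual (LinearMap.single A M i) φ
            map_add' := fun φ ψ ↦ funext fun i ↦ map_add _ φ ψ
            map_smul' := fun a φ ↦ funext fun i ↦ map_smul _ a φ
            invFun := fun ψ ↦ ∑ i, CharacterModule.dual (LinearMap.proj i : (Π j, M j) →ₗ[A] M i) (ψ i)
            left_inv := fun φ ↦ ?_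
            right_inv := fun ψ ↦ ?_ }, fun φ i x ↦ rfl⟩
  · -- `Σ_i φ(single_i (x i)) = φ x`
    ext x
    rw [characterModule_sum_apply]
    have : ∀ i, (CharacterModule.dual (LinearMap.proj i : (Π j, M j) →ₗ[A] M i)
        (CharacterModule.dual (LinearMap.single A M i) φ)) x = φ (Pi.single i (x i)) := fun i ↦ rfl
    simp only [this, ← map_sum]
    exact congrArg φ (Finset.univ_sum_single x)
  · -- `(Σ_j ψ_j ∘ proj_j) (single_i x) = ψ_i x`
    funext i
    ext x
    change (∑ j, CharacterModule.dual (LinearMap.proj j : (Π k, M k) →ₗ[A] M j) (ψ j)) (Pi.single i x) = ψ i x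
    rw [characterModule_sum_apply]
    have : ∀ j, (CharacterModule.dual (LinearMap.proj j : (Π k, M k) →ₗ[A] M j) (ψ j)) (Pi.single i x) =
        ψ j (Pi.single (M := M) i x j) := fun j ↦ rfl
    simp only [this]
    rw [Finset.sum_eq_single i (fun j _ hj ↦ by rw [Pi.single_eq_of_ne hj, map_zero])
      (fun h ↦ absurd (Finset.mem_univ i) h), Pi.single_eq_same]

/-- **`λ((Π_i M_i)⋆) = Σ_i λ(M_i⋆)`** for a finite family (the `S₀`-local count is additive over `v ∈ S₀`).
[cite: GreenbergVatsal2000, §2 (Prop. 2.4)] -/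
theorem finrank_baseChange_characterModule_pi [∀ i, Module.Finite K (K ⊗[A] CharacterModule (M i))] :
    Module.finrank K (K ⊗[A] CharacterModule (Π i, M i)) = ∑ i, Module.finrank K (K ⊗[A] CharacterModule (M i)) := by
  obtain ⟨e, -⟩ := exists_characterModule_pi_linearEquiv (A := A) M
  rw [(e.baseChange A K _ _).finrank_eq, (TensorProduct.piRight A K K fun i ↦ CharacterModule (M i)).finrank_eq,
    Module.finrank_pi_fintype]

end Pi

end Summit.BirchSwinnertonDyer.BirchSwinnertonDyer.Theorems.CharIdealLambda

end
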